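import Mathlib
import Summits.Ventures.HodgeRepro0.P6AokiQuotientDefs

/-!
# Aoki's quotient `B_q/(S_q + D_q)` at explicit levels — kernel certificates (part 2: dense list vectors, parity functionals, the generator permutation facts, the action through generators)

The objects are Aoki's (Math. Ann. 266 (1983), pp. 25–26, 36, as the cell's records transcribe them):
`R_q` = the free abelian group on `ℤ/q ∖ {0}`, here `Fin (q-1) → ℤ` with index `a - 1 ↔ (a)`;
`θ_t(α) = Σ_a c_a (⟨t·a/q⟩ − 1/2)` for units `t`, here scaled by `2q`: `thetaN q t a = 2·((t·a) mod q) − q`;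
`B_q = Ker θ`; the standard elements `σ_{p,i}`; `D_q` spanned by the pairs `(a) + (−a)` (and `(q/2)`);
`S_q + D_q` = the `ℤ`-span of all standard elements and pairs (the `ℤ[G_q]`-span, since `G_q` permutes them).
Part 2 bridges kernel-computable list data to the vectors of part 1, and proves `σ_1 = id`, `σ_t ∘ σ_{t'} = σ_{tt' mod q}` and the closure of the action properties along words in generators.
-/

namespace HodgeRepro0.P6AokiQuotient

/-! ### Dense list vectors and their bridge to `Fin (q-1) → ℤ` -/

/-- The zero list of length `n`. -/
def zeroL (n : ℕ) : List ℤ := List.replicate n 0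
/-- Pointwise sum of two lists. -/
def vaddL (u v : List ℤ) : List ℤ := List.zipWith (· + ·) u v
/-- Pointwise difference of two lists. -/
def vsubL (u v : List ℤ) : List ℤ := List.zipWith (· - ·) u v
/-- Scalar multiple of a list. -/
def smulL (c : ℤ) (v : List ℤ) : List ℤ := v.map (fun x => c * x)
/-- The dense list of `Σ_{a ∈ es} (a)`. -/
def denseOf (q : ℕ) (es : List ℕ) : List ℤ := (List.range (q - 1)).map (fun j => (es.count (j + 1) : ℤ))
/-- Integer combination `Σ c·L[g]` of rows of `LD`, from index/coefficient pairs. -/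
def lincombList (n : ℕ) (cs : List (ℕ × ℤ)) (LD : List (List ℤ)) : List ℤ :=
  cs.foldr (fun gc acc => vaddL (smulL gc.2 (LD.getD gc.1 (zeroL n))) acc) (zeroL n)
/-- The same combination of vectors. -/
def lincombF {n : ℕ} (cs : List (ℕ × ℤ)) (L : List (Fin n → ℤ)) : Fin n → ℤ :=
  cs.foldr (fun gc acc => gc.2 • L.getD gc.1 0 + acc) 0
/-- The generator vectors of `S_q + D_q`. -/
def genV (q : ℕ) : List (Fin (q - 1) → ℤ) := (genEntries q).map (vecOf q)
/-- The generator vectors of `S_q + D_q` as dense lists. -/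
def genDense (q : ℕ) : List (List ℤ) := (genEntries q).map (denseOf q)

/-- Length of the zero list. -/
theorem length_zeroL (n : ℕ) : (zeroL n).length = n := by simp [zeroL]
/-- Length of a pointwise sum. -/
theorem length_vaddL {n : ℕ} {u v : List ℤ} (hu : u.length = n) (hv : v.length = n) : (vaddL u v).length = n := by
  simp [vaddL, hu, hv]
/-- Length of a pointwise difference. -/
theorem length_vsubL {n : ℕ} {u v : List ℤ} (hu : u.length = n) (hv : v.length = n) : (vsubL u v).length = n := by
  simp [vsubL, hu, hv]
/-- Length of a scalar multiple. -/
theorem length_smulL (c : ℤ) (v : List ℤ) : (smulL c v).length = v.length := by simp [smulL]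
/-- Length of a dense generator list. -/
theorem length_denseOf (q : ℕ) (es : List ℕ) : (denseOf q es).length = q - 1 := by simp [denseOf]
/-- Length of an integer combination of rows of length `n`. -/
theorem length_lincombList (n : ℕ) (cs : List (ℕ × ℤ)) (LD : List (List ℤ)) (hLD : ∀ l ∈ LD, l.length = n) :
    (lincombList n cs LD).length = n := by
  induction cs with
  | nil => simp [lincombList, length_zeroL]
  | cons gc cs ih =>
    simp only [lincombList, List.foldr_cons] at ih ⊢
    apply length_vaddL _ ih
    rw [length_smulL]
    by_cases h : gc.1 < LD.length
    · rw [List.getD_eq_getElem _ _ h]; exact hLD _ (List.getElem_mem h)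
    · rw [List.getD_eq_default _ _ (by omega)]; exact length_zeroL n

/-- The zero list is the zero vector. -/
theorem toV_zeroL (n : ℕ) : toV n (zeroL n) = 0 := by
  funext i; simp [toV, zeroL]

/-- `toV` of a pointwise sum. -/
theorem toV_vaddL {n : ℕ} {u v : List ℤ} (hu : u.length = n) (hv : v.length = n) :
    toV n (vaddL u v) = toV n u + toV n v := by
  funext i
  have h1 : i.val < (vaddL u v).length := by rw [length_vaddL hu hv]; exact i.isLt
  have h2 : i.val < u.length := by rw [hu]; exact i.isLt
  have h3 : i.val < v.length := by rw [hv]; exact i.isLt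
  show (vaddL u v).getD i.val 0 = u.getD i.val 0 + v.getD i.val 0
  rw [List.getD_eq_getElem _ _ h1, List.getD_eq_getElem _ _ h2, List.getD_eq_getElem _ _ h3]
  simp [vaddL, List.getElem_zipWith]

/-- `toV` of a pointwise difference. -/
theorem toV_vsubL {n : ℕ} {u v : List ℤ} (hu : u.length = n) (hv : v.length = n) :
    toV n (vsubL u v) = toV n u - toV n v := by
  funext i
  have h1 : i.val < (vsubL u v).length := by rw [length_vsubL hu hv]; exact i.isLt
  have h2 : i.val < u.length := by rw [hu]; exact i.isLt
  have h3 : i.val < v.length := by rw [hv]; exact i.isLt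
  show (vsubL u v).getD i.val 0 = u.getD i.val 0 - v.getD i.val 0
  rw [List.getD_eq_getElem _ _ h1, List.getD_eq_getElem _ _ h2, List.getD_eq_getElem _ _ h3]
  simp [vsubL, List.getElem_zipWith]

/-- `toV` of a scalar multiple. -/
theorem toV_smulL {n : ℕ} (c : ℤ) {v : List ℤ} (hv : v.length = n) : toV n (smulL c v) = c • toV n v := by
  funext i
  have h1 : i.val < (smulL c v).length := by rw [length_smulL, hv]; exact i.isLt
  have h2 : i.val < v.length := by rw [hv]; exact i.isLt
  show (smulL c v).getD i.val 0 = c * v.getD i.val 0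
  rw [List.getD_eq_getElem _ _ h1, List.getD_eq_getElem _ _ h2]
  simp [smulL]

/-- `toV` of the dense generator list is the generator. -/
theorem toV_denseOf (q : ℕ) (es : List ℕ) : toV (q - 1) (denseOf q es) = vecOf q es := by
  funext i
  simp [toV, denseOf, vecOf]

/-- `toV` of a list combination is the vector combination. -/
theorem toV_lincombList (n : ℕ) (cs : List (ℕ × ℤ)) (LD : List (List ℤ)) (hLD : ∀ l ∈ LD, l.length = n) :
    toV n (lincombList n cs LD) = lincombF cs (LD.map (toV n)) := by
  induction cs with
  | nil => simp [lincombList, lincombF, toV_zeroL]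
  | cons gc cs ih =>
    have hlen : (LD.getD gc.1 (zeroL n)).length = n := by
      by_cases h : gc.1 < LD.length
      · rw [List.getD_eq_getElem _ _ h]; exact hLD _ (List.getElem_mem h)
      · rw [List.getD_eq_default _ _ (by omega)]; exact length_zeroL n
    rw [show lincombList n (gc :: cs) LD = vaddL (smulL gc.2 (LD.getD gc.1 (zeroL n))) (lincombList n cs LD) from rfl,
      show lincombF (gc :: cs) (LD.map (toV n)) = gc.2 • (LD.map (toV n)).getD gc.1 0 + lincombF cs (LD.map (toV n)) from rfl,
      toV_vaddL (by rw [length_smulL, hlen]) (length_lincombList n cs LD hLD), toV_smulL _ hlen, ih]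
    congr 2
    by_cases h : gc.1 < LD.length
    · rw [List.getD_eq_getElem _ _ h, List.getD_eq_getElem _ _ (by simpa using h), List.getElem_map]
    · rw [List.getD_eq_default _ _ (by omega), List.getD_eq_default _ _ (by simpa using h), toV_zeroL]

/-- A combination of vectors of a submodule lies in it. -/
theorem lincombF_mem {n : ℕ} (N : Submodule ℤ (Fin n → ℤ)) (L : List (Fin n → ℤ)) (hL : ∀ w ∈ L, w ∈ N)
    (cs : List (ℕ × ℤ)) : lincombF cs L ∈ N := by
  induction cs with
  | nil => simp [lincombF]
  | cons gc cs ih =>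
    simp only [lincombF, List.foldr_cons] at ih ⊢
    apply N.add_mem _ ih
    apply N.smul_mem
    by_cases h : gc.1 < L.length
    · rw [List.getD_eq_getElem _ _ h]; exact hL _ (List.getElem_mem h)
    · rw [List.getD_eq_default _ _ (by omega)]; exact N.zero_mem

/-- The dense generators map to the generator vectors. -/
theorem genDense_map_toV (q : ℕ) : (genDense q).map (toV (q - 1)) = genV q := by
  simp [genDense, genV, List.map_map, Function.comp_def, toV_denseOf]

/-- Dense generators have length `q - 1`. -/
theorem genDense_length (q : ℕ) : ∀ l ∈ genDense q, l.length = q - 1 := by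
  intro l hl
  simp only [genDense, List.mem_map] at hl
  obtain ⟨es, _, rfl⟩ := hl
  exact length_denseOf q es

/-- The generator vectors lie in `S_q + D_q`. -/
theorem genV_mem_SD (q : ℕ) : ∀ w ∈ genV q, w ∈ SD q := by
  intro w hw
  simp only [genV, List.mem_map] at hw
  obtain ⟨es, hes, rfl⟩ := hw
  exact vecOf_mem_SD hes

/-- A dense list identity `l = Σ c·gen` gives membership of `toV l` in `S_q + D_q`. -/
theorem toV_mem_SD_of_lincomb (q : ℕ) (l : List ℤ) (cs : List (ℕ × ℤ))
    (h : l = lincombList (q - 1) cs (genDense q)) : toV (q - 1) l ∈ SD q := by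
  rw [h, toV_lincombList _ _ _ (genDense_length q), genDense_map_toV]
  exact lincombF_mem _ _ (genV_mem_SD q) cs


/-! ### Parity functionals, `σ_t` on dense lists, and the generator permutation facts -/

/-- The parity functional `v ↦ Σ_a f_a v_a (mod 2)` attached to a list `f`. -/
def parF (n : ℕ) (f : List ℤ) : (Fin n → ℤ) →ₗ[ℤ] ZMod 2 :=
  Fintype.linearCombination ℤ (fun a : Fin n => ((f.getD a.val 0 : ℤ) : ZMod 2))

/-- The value of a parity functional. -/
theorem parF_apply (n : ℕ) (f : List ℤ) (v : Fin n → ℤ) :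
    parF n f v = ((∑ a, f.getD a.val 0 * v a : ℤ) : ZMod 2) := by
  simp only [parF, Fintype.linearCombination_apply, zsmul_eq_mul]
  push_cast
  apply Finset.sum_congr rfl; intro a _; ring

/-- A parity functional on `Σ_{a ∈ es} (a)` is the parity of a list sum. -/
theorem parF_vecOf (q : ℕ) (f : List ℤ) (es : List ℕ) (hes : ∀ a ∈ es, 1 ≤ a ∧ a ≤ q - 1) :
    parF (q - 1) f (vecOf q es) = (((es.map (fun a => f.getD (a - 1) 0)).sum : ℤ) : ZMod 2) := by
  rw [parF_apply, ← sum_mul_vecOf q (fun a => f.getD (a - 1) 0) es hes]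
  congr 2

/-- A parity functional on a dense vector is the parity of a list dot product. -/
theorem parF_toV (n : ℕ) (f l : List ℤ) :
    parF n f (toV n l) = ((((List.range n).map (fun a => f.getD a 0 * l.getD a 0)).sum : ℤ) : ZMod 2) := by
  rw [parF_apply, ← sum_fin_eq_list n (fun a => f.getD a 0 * l.getD a 0)]; rfl

/-- `S_q + D_q ⊆ Ker (parF f)` from the parity of `f` on the generator entry lists. -/
theorem SD_le_ker_parF (q : ℕ) (f : List ℤ) (hbound : ∀ es ∈ genEntries q, ∀ a ∈ es, 1 ≤ a ∧ a ≤ q - 1)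
    (h : ∀ es ∈ genEntries q, (es.map (fun a => f.getD (a - 1) 0)).sum % 2 = 0) :
    SD q ≤ LinearMap.ker (parF (q - 1) f) := by
  apply Submodule.span_le.mpr
  rintro v ⟨es, hes, rfl⟩
  rw [SetLike.mem_coe, LinearMap.mem_ker, parF_vecOf q f es (hbound es hes)]
  exact (ZMod.intCast_zmod_eq_zero_iff_dvd _ 2).mpr (Int.dvd_of_emod_eq_zero (h es hes))

/-- `σ_t` on dense lists (the pushforward sum). -/
def sigmaList (q t : ℕ) (l : List ℤ) : List ℤ :=
  (List.range (q - 1)).map (fun b => ((List.range (q - 1)).map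
    (fun a => if (t * (a + 1)) % q = b + 1 then l.getD a 0 else 0)).sum)

/-- Length of `sigmaList`. -/
theorem length_sigmaList (q t : ℕ) (l : List ℤ) : (sigmaList q t l).length = q - 1 := by simp [sigmaList]

/-- `toV` of `sigmaList` is `sigma` of `toV`. -/
theorem toV_sigmaList (q t : ℕ) (l : List ℤ) : toV (q - 1) (sigmaList q t l) = sigma q t (toV (q - 1) l) := by
  funext b
  have hb : b.val < (sigmaList q t l).length := by rw [length_sigmaList]; exact b.isLt
  show (sigmaList q t l).getD b.val 0 = sigma q t (toV (q - 1) l) b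
  rw [List.getD_eq_getElem _ _ hb]
  simp only [sigmaList, List.getElem_map, List.getElem_range, sigma, toV]
  exact (sum_fin_eq_list (q - 1) (fun a => if (t * (a + 1)) % q = b.val + 1 then l.getD a 0 else 0)).symm

/-- The generator permutation facts F1–F4 give the hypothesis of `sigma_SD_le`. -/
theorem hperm_of_facts (q t : ℕ)
    (F1 : ∀ p ∈ oddPrimeDivisors q, ∀ i ∈ admissible q p, (t * i) % q ∈ admissible q p ∧
      ((stdEntries q p i).map (fun a => (t * a) % q)).Perm (stdEntries q p ((t * i) % q)))
    (F2 : ∀ j < (q - 1) / 2, ∃ j' < (q - 1) / 2,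
      (([j + 1, q - (j + 1)]).map (fun a => (t * a) % q)).Perm [j' + 1, q - (j' + 1)])
    (F3 : q % 2 = 0 → (t * (q / 2)) % q = q / 2)
    (F4 : q % 4 = 0 → ∀ i ∈ admissible q 2, (t * i) % q ∈ admissible q 2 ∧
      ((std2Entries q i).map (fun a => (t * a) % q)).Perm (std2Entries q ((t * i) % q))) :
    ∀ es ∈ genEntries q, ∃ es' ∈ genEntries q, (es.map (fun a => (t * a) % q)).Perm es' := by
  intro es hes
  simp only [genEntries, stdEntriesList, pairEntriesList, List.mem_append, List.mem_flatMap,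
    List.mem_map, List.mem_range] at hes
  rcases hes with (⟨p, hp, i, hi, rfl⟩ | h2) | (⟨j, hj, rfl⟩ | h4)
  · obtain ⟨hi', hperm⟩ := F1 p hp i hi
    exact ⟨_, List.mem_append.mpr (Or.inl (stdEntries_mem hp hi')), hperm⟩
  · split_ifs at h2 with h4q
    · simp only [List.mem_map] at h2
      obtain ⟨i, hi, rfl⟩ := h2
      obtain ⟨hi', hperm⟩ := F4 h4q i hi
      exact ⟨_, List.mem_append.mpr (Or.inl (std2Entries_mem h4q hi')), hperm⟩
    · simp at h2
  · obtain ⟨j', hj', hperm⟩ := F2 j hj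
    exact ⟨_, List.mem_append.mpr (Or.inr (pair_mem hj')), hperm⟩
  · split_ifs at h4 with h2q
    · simp only [List.mem_singleton] at h4
      subst h4
      refine ⟨[q / 2], List.mem_append.mpr (Or.inr (half_mem h2q)), ?_⟩
      simp [F3 h2q]
    · simp at h4


/-! ### The group action through generators: `σ_1 = id`, `σ_t ∘ σ_{t'} = σ_{tt' mod q}` -/

/-- `σ_1` is the identity. -/
theorem sigma_one (q : ℕ) (v : Fin (q - 1) → ℤ) : sigma q 1 v = v := by
  funext b
  simp only [sigma, one_mul]
  rw [Finset.sum_eq_single b]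
  · rw [if_pos (Nat.mod_eq_of_lt (by have := b.isLt; omega))]
  · intro a _ hab
    rw [if_neg]
    intro h
    rw [Nat.mod_eq_of_lt (by have := a.isLt; omega)] at h
    exact hab (Fin.ext (by omega))
  · intro h; exact absurd (Finset.mem_univ b) h

/-- `σ_t ∘ σ_{t'} = σ_{t t' mod q}` when `t'` is coprime to `q`. -/
theorem sigma_sigma (q t t' : ℕ) (ht' : Nat.Coprime t' q) (v : Fin (q - 1) → ℤ) :
    sigma q t (sigma q t' v) = sigma q ((t * t') % q) v := by
  funext b
  have hq : 0 < q := by have := b.isLt; omega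
  simp only [sigma]
  have h1 : ∀ a : Fin (q - 1),
      (if t * (a.val + 1) % q = b.val + 1 then ∑ c, (if t' * (c.val + 1) % q = a.val + 1 then v c else 0) else 0)
      = ∑ c : Fin (q - 1), if (t * (a.val + 1) % q = b.val + 1 ∧ t' * (c.val + 1) % q = a.val + 1) then v c else 0 := by
    intro a
    split_ifs with h
    · apply Finset.sum_congr rfl; intro c _; simp [h]
    · simp [h]
  simp only [h1]
  rw [Finset.sum_comm]
  apply Finset.sum_congr rfl
  intro c _
  have hne : t' * (c.val + 1) % q ≠ 0 := by
    intro h0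
    have hdvd : q ∣ t' * (c.val + 1) := Nat.dvd_of_mod_eq_zero h0
    have h2 : q ∣ c.val + 1 := (Nat.coprime_comm.mp ht').dvd_of_dvd_mul_left hdvd
    have := Nat.le_of_dvd (by omega) h2
    have := c.isLt
    omega
  have hlt := Nat.mod_lt (t' * (c.val + 1)) hq
  set a0 : Fin (q - 1) := ⟨t' * (c.val + 1) % q - 1, by omega⟩ with ha0
  have e1 : a0.val + 1 = t' * (c.val + 1) % q := by simp only [ha0]; omega
  rw [Finset.sum_eq_single a0]
  · have e2 : t * (a0.val + 1) % q = (t * t') % q * (c.val + 1) % q := by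
      rw [e1]
      have m1 : t * (t' * (c.val + 1) % q) % q = t * (t' * (c.val + 1)) % q :=
        Nat.ModEq.mul_left t (Nat.mod_modEq _ _)
      have m2 : (t * t') % q * (c.val + 1) % q = t * t' * (c.val + 1) % q :=
        Nat.ModEq.mul_right (c.val + 1) (Nat.mod_modEq _ _)
      rw [m1, m2, mul_assoc]
    rw [e2]
    simp only [e1, and_true]
  · intro a _ ha
    rw [if_neg]
    rintro ⟨_, h2⟩
    apply ha
    apply Fin.ext
    simp only [ha0]
    omega
  · intro h; exact absurd (Finset.mem_univ a0) h

/-- `σ_{t t' mod q}` as a composite of linear maps. -/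
theorem sigmaL_mul (q t t' : ℕ) (ht' : Nat.Coprime t' q) :
    sigmaL q ((t * t') % q) = (sigmaL q t).comp (sigmaL q t') := by
  apply LinearMap.ext; intro v
  simp only [LinearMap.comp_apply, sigmaL_apply, sigma_sigma q t t' ht' v]

/-- The closure property: `σ_t(N) ⊆ N` and `σ_t β_j − β_j ∈ N` for `t = 1`, and for `(x·g) mod q` whenever
it holds for `x` and for the unit `g`. -/
theorem act_word (q : ℕ) (N : Submodule ℤ (Fin (q - 1) → ℤ)) {k : ℕ} (β : Fin k → Fin (q - 1) → ℤ)
    (gens : List ℕ) (hg : ∀ g ∈ gens, Nat.Coprime g q ∧ Submodule.map (sigmaL q g) N ≤ N ∧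
      ∀ j, sigmaL q g (β j) - β j ∈ N)
    (w : List ℕ) :
    Submodule.map (sigmaL q (w.foldl (fun x i => (x * gens.getD i 1) % q) 1)) N ≤ N ∧
      ∀ j, sigmaL q (w.foldl (fun x i => (x * gens.getD i 1) % q) 1) (β j) - β j ∈ N := by
  suffices h : ∀ x, (Submodule.map (sigmaL q x) N ≤ N ∧ ∀ j, sigmaL q x (β j) - β j ∈ N) →
      Submodule.map (sigmaL q (w.foldl (fun x i => (x * gens.getD i 1) % q) x)) N ≤ N ∧
      ∀ j, sigmaL q (w.foldl (fun x i => (x * gens.getD i 1) % q) x) (β j) - β j ∈ N by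
    apply h 1
    have hid : sigmaL q 1 = LinearMap.id := by
      apply LinearMap.ext; intro v; simp [sigmaL_apply, sigma_one]
    rw [hid]; simp
  induction w with
  | nil => intro x hx; simpa using hx
  | cons i w ih =>
    intro x hx
    simp only [List.foldl_cons]
    apply ih
    -- the step: from `P x` and `P g` to `P ((x * g) % q)`
    have hgi : Nat.Coprime (gens.getD i 1) q ∧ Submodule.map (sigmaL q (gens.getD i 1)) N ≤ N ∧
        ∀ j, sigmaL q (gens.getD i 1) (β j) - β j ∈ N := by
      by_cases hi : i < gens.length
      · rw [List.getD_eq_getElem _ _ hi]; exact hg _ (List.getElem_mem hi)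
      · rw [List.getD_eq_default _ _ (by omega)]
        refine ⟨Nat.coprime_one_left q, ?_, ?_⟩
        · have hid : sigmaL q 1 = LinearMap.id := by
            apply LinearMap.ext; intro v; simp [sigmaL_apply, sigma_one]
          rw [hid]; simp
        · intro j; simp [sigmaL_apply, sigma_one]
    obtain ⟨hcop, hN, hβ⟩ := hgi
    rw [sigmaL_mul q x _ hcop]
    constructor
    · rw [Submodule.map_comp]
      exact le_trans (Submodule.map_mono hN) hx.1
    · intro j
      have : (sigmaL q x).comp (sigmaL q (gens.getD i 1)) (β j) - β j
          = sigmaL q x (sigmaL q (gens.getD i 1) (β j) - β j) + (sigmaL q x (β j) - β j) := by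
        simp only [LinearMap.comp_apply, map_sub]; abel
      rw [this]
      exact N.add_mem (hx.1 (Submodule.mem_map_of_mem (hβ j))) (hx.2 j)

end HodgeRepro0.P6AokiQuotient
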